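import Summits.Langlands.Langlands.Theorems.CoreAdequacySplitNoAdequateLayerLiftingStubCoprimeTableLiftingBridgeConverse
import Literature.RepresentationTheory.FiniteGroups.WeakAdequacyLowDegree

/-!
# RSL `CoreAdequacySplit.NoAdequateLayerLifting` (stmt-Langlands-27954), line `birth`, stub 3/3 `stub_coprimeTableLifting` — STRUCTURAL HELPERS, part 6:
# the rows `n < ℓ` of the TABLE are COHOMOLOGICAL (weak adequacy is automatic there — Guralnick–Herzig–Tiep 2015, Thm. 1.2)

On the rows `n < ℓ < 2(n+1)` of the TABLE (e.g. `(2,5)`, `(3,5)`, `(3,7)`, `(4,5)`, `(4,7)`, `(5,7)`, `(5,11)`, …) the printed theorem GHT 2015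
Thm. 1.2 — the landed NAMED FACT `Literature.RepresentationTheory.FiniteGroups.GuralnickHerzigTiep2015_thm_1_2_of_lt` (special case `dim V < p`; statement only, D-0014) — says that every
finite absolutely irreducible `H ≤ GL_n(𝔽̄_ℓ)` is WEAKLY ADEQUATE: its semisimple elements span `M_n`.  By the 2012 ⇄ 2017 bridge (parts 2, 4) the
RSL hypotheses «no adequate image / layer» then reduce, on these rows, to a purely COHOMOLOGICAL obstruction at every absolutely irreducible layer
`J` of the image: `Hom(J, 𝔽̄_ℓ) ≠ 0` or `H¹(J, ad/Z) ≠ 0` (equivalently `Ext¹_J(V,V) ≠ 0`) — the «LIE» shape recorded by the census (I-L5g12: every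
computed coprime row fails only the `H¹` clause).  Conditional on the named fact; nothing else assumed.  No new definition; 0 sorry.
-/

set_option linter.dupNamespace false

namespace Summit.Langlands.Langlands.Theorems.CoreAdequacy.CoprimeTable

open scoped MatrixGroups
open Literature.NumberTheory.GaloisRepresentations
open Summit.Langlands.Langlands.Theses
open Literature.RepresentationTheory.FiniteGroups (GuralnickHerzigTiep2015_thm_1_2_of_lt)

section LowRows

variable {K : Type} [Field K] [NumberField K] {ℓ : ℕ} [Fact ℓ.Prime] {n : ℕ}

/-- **Rows `n < ℓ`: every finite absolutely irreducible layer of the residual image is weakly adequate** (GHT 2015 Thm. 1.2), so — by the bridge —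
it is Thorne-2012-adequate iff `Hom(J, 𝔽̄_ℓ) = 0` and `H¹(J, ad/Z) = 0`. -/
theorem isThorneAdequate_iff_cohomology_of_lt (hGHT : GuralnickHerzigTiep2015_thm_1_2_of_lt) (hnℓ : n < ℓ) (hn : 0 < n)
    (J : Subgroup (GL (Fin n) (padicAlgClResidueField ℓ))) [Finite J] (hJ : IsAbsIrreducible J.subtype) :
    Subgroup.IsThorneAdequate J ↔
      ((∀ f : Additive J →+ padicAlgClResidueField ℓ, f = 0) ∧
        groupCohomology.cocycles₁ (Rep.of (Subgroup.adModScalarRep J)) ≤ groupCohomology.coboundaries₁ (Rep.of (Subgroup.adModScalarRep J))) := by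
  haveI : IsAlgClosed (padicAlgClResidueField ℓ) := Literature.RingTheory.Valuation.isAlgClosed_residueField (padicAlgClIntegers ℓ)
  haveI := charP_padicAlgClResidueField ℓ
  have hℓn : ¬ ℓ ∣ n := fun h => absurd (Nat.le_of_dvd hn h) (not_le.2 hnℓ)
  have hspan : Subgroup.semisimpleSpan J = ⊤ := hGHT (padicAlgClResidueField ℓ) ℓ n J inferInstance hJ hnℓ
  rw [isThorneAdequate_iff_isExtendedAdequate (natCast_ne_zero_of_not_dvd hℓn) J, Subgroup.isExtendedAdequate_iff]
  exact ⟨fun h => ⟨h.1, h.2.1⟩, fun h => ⟨h.1, h.2, hspan⟩⟩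

/-- **Rows `n < ℓ` of the TABLE are cohomological at the image**: for an RSL instance with `n < ℓ` (¬ADQ) and any finite-image absolutely
irreducible reduction `τ` over `K(ζ_ℓ)`: the image is weakly adequate, and `Hom(I, 𝔽̄_ℓ) ≠ 0` or `H¹(I, ad/Z) ≠ 0` (GHT 2015 Thm. 1.2 granted). -/
theorem cohomological_obstruction_image_of_lt (hGHT : GuralnickHerzigTiep2015_thm_1_2_of_lt) (hnℓ : n < ℓ) {ρ : FramedGaloisRep K (PadicAlgCl ℓ) n}
    (hA : ¬ AdequateCyclotomicImage ρ) {τ : Field.absoluteGaloisGroup (CyclotomicField ℓ K) →* GL (Fin n) (padicAlgClResidueField ℓ)}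
    (hτ : (ρ.restrictField (CyclotomicField ℓ K)).IsReductionOf (RingHom.id _) τ) (hirr : IsAbsIrreducible τ) :
    Subgroup.semisimpleSpan τ.range = ⊤ ∧
      ¬ ((∀ f : Additive τ.range →+ padicAlgClResidueField ℓ, f = 0) ∧
        groupCohomology.cocycles₁ (Rep.of (Subgroup.adModScalarRep τ.range)) ≤ groupCohomology.coboundaries₁ (Rep.of (Subgroup.adModScalarRep τ.range))) := by
  haveI := charP_padicAlgClResidueField ℓ
  haveI : Finite τ.range := finite_range_of_isReductionOf hτ
  have hn : 0 < n := hirr.pos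
  refine ⟨hGHT (padicAlgClResidueField ℓ) ℓ n τ.range inferInstance hirr.range_subtype hnℓ, fun h => hA ⟨τ, hτ, hirr, ?_⟩⟩
  exact (isThorneAdequate_iff_cohomology_of_lt hGHT hnℓ hn τ.range hirr.range_subtype).2 h

/-- **Rows `n < ℓ` of the TABLE are cohomological at EVERY layer**: for an RSL instance with `n < ℓ` (¬SADQ), any absolutely irreducible reduction
`τ` over `K(ζ_ℓ)` and any absolutely irreducible layer `perfectCore I ≤ J ≤ I` of its image: `J` is weakly adequate and `Hom(J, 𝔽̄_ℓ) ≠ 0` or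
`H¹(J, ad/Z) ≠ 0` (GHT 2015 Thm. 1.2 granted) — the LIE shape of the coprime rows with `n < ℓ`. -/
theorem cohomological_obstruction_layer_of_lt (hGHT : GuralnickHerzigTiep2015_thm_1_2_of_lt) (hnℓ : n < ℓ) {ρ : FramedGaloisRep K (PadicAlgCl ℓ) n}
    (hN : ¬ SolvablyAdequateImage ρ) {τ : Field.absoluteGaloisGroup (CyclotomicField ℓ K) →* GL (Fin n) (padicAlgClResidueField ℓ)}
    (hτ : (ρ.restrictField (CyclotomicField ℓ K)).IsReductionOf (RingHom.id _) τ) (hirr : IsAbsIrreducible τ)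
    {J : Subgroup (GL (Fin n) (padicAlgClResidueField ℓ))} (hPJ : perfectCore τ.range ≤ J) (hJI : J ≤ τ.range) (hJ : IsAbsIrreducible J.subtype) :
    Subgroup.semisimpleSpan J = ⊤ ∧
      ¬ ((∀ f : Additive J →+ padicAlgClResidueField ℓ, f = 0) ∧
        groupCohomology.cocycles₁ (Rep.of (Subgroup.adModScalarRep J)) ≤ groupCohomology.coboundaries₁ (Rep.of (Subgroup.adModScalarRep J))) := by
  haveI := charP_padicAlgClResidueField ℓ
  haveI : Finite τ.range := finite_range_of_isReductionOf hτ
  haveI : Finite J := Finite.of_injective _ (Subgroup.inclusion_injective hJI)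
  have hn : 0 < n := hirr.pos
  refine ⟨hGHT (padicAlgClResidueField ℓ) ℓ n J inferInstance hJ hnℓ, fun h => hN ((solvablyAdequateImage_iff ρ).2 ⟨τ, hτ, hirr, perfectCore τ.range, J,
    isPerfectCore_perfectCore τ.range, hPJ, hJI, hJ, ?_⟩)⟩
  exact (isThorneAdequate_iff_cohomology_of_lt hGHT hnℓ hn J hJ).2 h

end LowRows

end Summit.Langlands.Langlands.Theorems.CoreAdequacy.CoprimeTable
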